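import Literature.Barriers.Parity.SiegelZeroDichotomyPairHLTypeIExpansion
import Literature.Barriers.Parity.SiegelZeroDichotomyPairHLProp72Tools
import Literature.Barriers.Parity.SiegelZeroDichotomyChowlaDivisorSums
import Mathlib.NumberTheory.Harmonic.Bounds
import HarnessLib

/-!
# Tao–Teräväinen 2022, §8 (`k = 2`): tools for the `χ`-twisted Type I sums

Topic `Literature/Barriers/Parity`, sub-namespace `TaoTeravainen`; companion of
`SiegelZeroDichotomyPairHLTypeIExpansion.lean` in step (v) of the proof DAG of
`Literature.Barriers.Parity.TaoTeravainen2021_prop72_81_pair` (T. Tao, J. Teräväinen, *The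
Hardy–Littlewood–Chowla conjecture in the presence of a Siegel zero*, J. London Math. Soc. (2) 106
(2022), arXiv:2109.06291), §8: "From Lemma 3.7(ii) and summation by parts to deal with the
`h_{d₁,…,d'_k}` coefficients, we may thus bound … by `≪_ε q_χ^{1/2+ε} log^{O(1)} x ∑_J ∑_{d_j, d'_j}
(d₁⋯d_k, q_χ)^{1/2} τ(d₁)^{O(1)}⋯τ(d_k)^{O(1)} (1/(q_χ d₁⋯d_k) + 1/x)` … One can calculate
`∑_{d ∈ ℕ_(p)} (d,q_χ)^{1/2} τ(d)^{O(1)}/d ≤ 1 + O(1/p)` when `p ∤ q_χ` and `≪ 1` otherwise, thus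
… `≪_ε q_χ^{-ε₀/2+ε} τ(q_χ)^{O(1)} log^{O(1)} x`." Everything here is PROVED:

* `abs_sum_mul_psiSharp_le` — summation by parts against the smooth weight `Ψ((n+h)/d)`
  (via its representation as a `u`-integral of the weights `Φ_{e^u d}`, whose total variation in
  `n` is `≤ 17 sup|φ'|`): `|∑_{n ≤ x} a_n Ψ((n+h)/d)| ≤ sup|ψ| (X+2)² (sup|φ| + 17 sup|φ'|) M` when
  all partial sums of `a` are `≤ M`;
* `sum_tau_pow_div_le` — `∑_{n ≤ K} τ(n)^j/n ≤ (1 + log K)^{2^j}` (local copy of a folklore bound),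
  `sum_tau_cube_sqrt_gcd_div_le` — `∑_{M ≤ Y} τ(M)³ √((M,q))/M ≤ τ(q)⁴ (1 + log Y)⁸`
  (the source's "`∑ (d,q_χ)^{1/2} τ(d)^{O(1)}/d ≪ τ(q_χ)^{O(1)} log^{O(1)} x`");
* `sum_triples_sqrt_gcd_div_lcm_le` — over triples `(b, e, e')` with `b ≤ B`, `e, e' < R`:
  `∑ √(([b,[e,e']], q))/[b,[e,e']] ≤ ∑_{M ≤ B⌈R⌉²} τ(M)³ √((M,q))/M` (each triple divides its `lcm`).
  [cite: TaoTeravainen2021, §8 (the case `ℓ > 0` and "The above arguments allow us to dispose of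
  the `g_{d,d'}` contributions")]
-/

noncomputable section

open Finset Real MeasureTheory
open scoped ContDiff Topology
open Literature.NumberTheory.Sieve.Vaughan (card_divisors_mul_le)

namespace Literature.Barriers.Parity

namespace TaoTeravainen

variable {q : ℕ}

/-! ### Summation by parts against `Ψ((n+h)/d)` -/

/-- `Ψ(m/d) = ∫_{U₀}^{T} w♯(u) u Φ_{e^u d}(m) du` for `m, d ≥ 1` with `log m ≤ T - 1 + log d`…
precisely: for `0 < m`, `0 < d`, `U₀ ≤ T` and `log m - log d + 1 ≤ T`,
`Ψ(m/d) = ∫_{U₀}^{T} w♯(u) (logBump φ (u + log d) m) u du`. [folklore] -/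
theorem psiSharp_div_eq_intervalIntegral {φ : ℝ → ℝ} (hφ : IsBump φ) (ψ : ℝ → ℝ) (X : ℝ) {U₀ T : ℝ}
    (hUT : U₀ ≤ T) {m d : ℕ} (hm : 0 < m) (hd : 0 < d) (hT : Real.log m - Real.log d + 1 ≤ T) :
    psiSharp φ ψ X U₀ ((m : ℝ) / d) =
      ∫ u in U₀..T, sharpWeight ψ X U₀ u * logBump φ (u + Real.log d) m * u := by
  unfold psiSharp
  have hmr : (0 : ℝ) < m := by exact_mod_cast hm
  have hdr : (0 : ℝ) < d := by exact_mod_cast hd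
  have hlog : Real.log ((m : ℝ) / d) = Real.log m - Real.log d := Real.log_div hmr.ne' hdr.ne'
  have hpt : ∀ u, sharpWeight ψ X U₀ u * φ (Real.log ((m : ℝ) / d) - u) * u =
      sharpWeight ψ X U₀ u * logBump φ (u + Real.log d) m * u := by
    intro u
    unfold logBump
    rw [if_pos hmr, hlog]
    ring_nf
  simp_rw [hpt]
  refine setIntegral_Ioi_eq_intervalIntegral hUT fun u hu => ?_
  unfold logBump
  rw [if_pos hmr, hφ.eq_zero _ ?_, mul_zero, zero_mul]
  rw [abs_of_nonpos (by linarith)]; linarith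

/-- **Summation by parts against `Ψ((n+h)/d)`**: if `|∑_{n ≤ N'} a_n| ≤ M` for all `N' ≤ x`, then
for `d ≥ 1`, `2 ≤ U₀ ≤ X + 2`, `log(x + h) ≤ X + 1`:
`|∑_{n=1}^{x} a_n Ψ((n+h)/d)| ≤ sup|ψ| (X+2)² (sup|φ| + 17 sup|φ'|) M`.
[cite: TaoTeravainen2021, §8 ("summation by parts to deal with the `h_{d₁,…,d'_k}` coefficients")] -/
theorem abs_sum_mul_psiSharp_le {φ ψ : ℝ → ℝ} (hφ : IsBump φ) (hψ : IsSmoothCutoff ψ)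
    {B₀ B₁ Bψ : ℝ} (hB₀ : ∀ u, |φ u| ≤ B₀) (hB₁ : ∀ u, |deriv φ u| ≤ B₁) (hBψ : ∀ u, |ψ u| ≤ Bψ)
    {X U₀ : ℝ} (hU₀ : 2 ≤ U₀) (hUX : U₀ ≤ X + 2) {x : ℕ} (h : ℕ) (hxX : Real.log ((x + h : ℕ) : ℝ) ≤ X + 1)
    {d : ℕ} (hd : 1 ≤ d) {a : ℕ → ℝ} {M : ℝ} (hM : 0 ≤ M)
    (ha : ∀ N' ∈ Icc 1 x, |∑ n ∈ Icc 1 N', a n| ≤ M) :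
    |∑ n ∈ Icc 1 x, a n * psiSharp φ ψ X U₀ (((n + h : ℕ) : ℝ) / d)| ≤
      Bψ * (X + 2) ^ 2 * (B₀ + 17 * B₁) * M := by
  have hB₀0 : 0 ≤ B₀ := (abs_nonneg _).trans (hB₀ 0)
  have hB₁0 : 0 ≤ B₁ := (abs_nonneg _).trans (hB₁ 0)
  have hBψ0 : 0 ≤ Bψ := (abs_nonneg _).trans (hBψ 0)
  have hd0 : (0 : ℝ) < d := by exact_mod_cast hd
  have hlogd : 0 ≤ Real.log d := Real.log_nonneg (by exact_mod_cast hd)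
  set T : ℝ := X + 2 with hT
  have hUT : U₀ ≤ T := hUX
  have hT0 : 0 ≤ T := by linarith
  -- each `Ψ((n+h)/d)` as an integral over `[U₀, T]`
  have hrep : ∀ n ∈ Icc 1 x, psiSharp φ ψ X U₀ (((n + h : ℕ) : ℝ) / d) =
      ∫ u in U₀..T, sharpWeight ψ X U₀ u * logBump φ (u + Real.log d) ((n + h : ℕ) : ℝ) * u := by
    intro n hn
    rw [mem_Icc] at hn
    refine psiSharp_div_eq_intervalIntegral hφ ψ X hUT (m := n + h) (d := d) (by omega) (by omega) ?_
    have h1 : Real.log ((n + h : ℕ) : ℝ) ≤ Real.log ((x + h : ℕ) : ℝ) :=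
      Real.log_le_log (by exact_mod_cast (show 0 < n + h by omega)) (by exact_mod_cast (show n + h ≤ x + h by omega))
    rw [hT]; linarith
  -- exchange sum and integral
  have hcw : Continuous (sharpWeight ψ X U₀) :=
    hψ.contDiff.continuous.comp ((continuous_const.sub continuous_id).div_const _)
  have hcL : ∀ n : ℕ, Continuous fun u => logBump φ (u + Real.log d) ((n + h : ℕ) : ℝ) := by
    intro n
    unfold logBump
    split_ifs
    · exact hφ.continuous.comp (continuous_const.sub (continuous_id.add continuous_const))
    · exact continuous_const
  have hid : ∑ n ∈ Icc 1 x, a n * psiSharp φ ψ X U₀ (((n + h : ℕ) : ℝ) / d) =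
      ∫ u in U₀..T, sharpWeight ψ X U₀ u * u *
        ∑ n ∈ Icc 1 x, a n * logBump φ (u + Real.log d) ((n + h : ℕ) : ℝ) := by
    rw [sum_congr rfl fun n hn => show a n * psiSharp φ ψ X U₀ (((n + h : ℕ) : ℝ) / d) =
      a n * ∫ u in U₀..T, sharpWeight ψ X U₀ u * logBump φ (u + Real.log d) ((n + h : ℕ) : ℝ) * u by
      rw [hrep n hn]]
    simp_rw [← intervalIntegral.integral_const_mul]
    rw [← intervalIntegral.integral_finsetSum fun n _ => ?_]
    · refine intervalIntegral.integral_congr fun u _ => ?_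
      simp only [mul_sum]
      refine sum_congr rfl fun n _ => by ring
    · exact ((continuous_const.mul (((hcw.mul (hcL n)).mul continuous_id))).intervalIntegrable _ _)
  rw [hid]
  -- the Abel bound for each `u`
  have habel : ∀ u, U₀ ≤ u → |∑ n ∈ Icc 1 x, a n * logBump φ (u + Real.log d) ((n + h : ℕ) : ℝ)| ≤ M * (B₀ + 17 * B₁) := by
    intro u hu
    have hv : 2 ≤ Real.exp (u + Real.log d - 1) := by
      have h1 : (1 : ℝ) ≤ u + Real.log d - 1 := by linarith
      calc (2 : ℝ) ≤ Real.exp 1 := by have := Real.exp_one_gt_d9; linarith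
        _ ≤ Real.exp (u + Real.log d - 1) := Real.exp_le_exp.mpr h1
    have h1 := abs_sum_Icc_mul_le_abel (lo := 1) (hi := x) (c := a)
      (W := fun N => logBump φ (u + Real.log d) ((N + h : ℕ) : ℝ)) hM ha
    refine h1.trans (mul_le_mul_of_nonneg_left ?_ hM)
    have hW : |logBump φ (u + Real.log d) ((x + h : ℕ) : ℝ)| ≤ B₀ := by
      unfold logBump; split_ifs
      · exact hB₀ _
      · rw [abs_zero]; exact hB₀0
    have hTV : ∑ N ∈ Ico 1 x, |logBump φ (u + Real.log d) ((N + h : ℕ) : ℝ) -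
        logBump φ (u + Real.log d) ((N + 1 + h : ℕ) : ℝ)| ≤ 17 * B₁ := by
      have hsub := sum_abs_logBump_sub_le hφ hB₁ hv (x + h)
      refine le_trans ?_ hsub
      -- reindex `m = N + h` and enlarge the range
      have hre : ∑ N ∈ Ico 1 x, |logBump φ (u + Real.log d) ((N + h : ℕ) : ℝ) -
          logBump φ (u + Real.log d) ((N + 1 + h : ℕ) : ℝ)| =
          ∑ m ∈ (Ico 1 x).map (addRightEmbedding h),
            |logBump φ (u + Real.log d) m - logBump φ (u + Real.log d) (m + 1)| := by
        rw [sum_map]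
        refine sum_congr rfl fun N _ => ?_
        simp only [addRightEmbedding_apply]
        rw [show N + 1 + h = N + h + 1 by ring]
        push_cast; ring_nf
      rw [hre]
      refine sum_le_sum_of_subset_of_nonneg ?_ fun m _ _ => abs_nonneg _
      intro m hm
      rw [mem_map] at hm
      obtain ⟨N, hN, rfl⟩ := hm
      rw [mem_Ico] at hN
      simp only [addRightEmbedding_apply, mem_Icc]
      omega
    have := add_le_add hW hTV
    simpa [add_comm, add_assoc] using this
  -- integrate
  have hbound : ∀ u ∈ Set.uIoc U₀ T, ‖sharpWeight ψ X U₀ u * u *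
      ∑ n ∈ Icc 1 x, a n * logBump φ (u + Real.log d) ((n + h : ℕ) : ℝ)‖ ≤ Bψ * T * (M * (B₀ + 17 * B₁)) := by
    intro u hu
    rw [Set.uIoc_of_le hUT, Set.mem_Ioc] at hu
    rw [Real.norm_eq_abs, abs_mul, abs_mul, abs_of_nonneg (by linarith [hu.1] : (0 : ℝ) ≤ u)]
    refine mul_le_mul (mul_le_mul (abs_sharpWeight_le hBψ X U₀ u) hu.2 (by linarith [hu.1]) hBψ0)
      (habel u hu.1.le) (abs_nonneg _) (by positivity)
  have hint := intervalIntegral.norm_integral_le_of_norm_le_const hbound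
  rw [Real.norm_eq_abs, abs_of_nonneg (by linarith : 0 ≤ T - U₀)] at hint
  refine hint.trans ?_
  have hTU : T - U₀ ≤ T := by linarith
  calc Bψ * T * (M * (B₀ + 17 * B₁)) * (T - U₀) ≤ Bψ * T * (M * (B₀ + 17 * B₁)) * T :=
        mul_le_mul_of_nonneg_left hTU (by positivity)
    _ = Bψ * (X + 2) ^ 2 * (B₀ + 17 * B₁) * M := by rw [hT]; ring

/-! ### Divisor sums -/

/-- `∑_{n ≤ K} τ(n)^{j+1}/n ≤ (∑_{n ≤ K} τ(n)^j/n)²`. [folklore] -/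
theorem sum_tau_pow_succ_div_le (j K : ℕ) :
    ∑ n ∈ Icc 1 K, ((#n.divisors : ℕ) : ℝ) ^ (j + 1) / n ≤
      (∑ n ∈ Icc 1 K, ((#n.divisors : ℕ) : ℝ) ^ j / n) ^ 2 := by
  classical
  have card_divisorsAntidiagonal_eq : ∀ n : ℕ, #n.divisorsAntidiagonal = #n.divisors :=
    fun n ↦ by rw [← Nat.map_div_right_divisors, Finset.card_map]
  have h1 : ∀ e ∈ Icc 1 K, ((#e.divisors : ℕ) : ℝ) ^ (j + 1) / e =
      ∑ p ∈ Nat.divisorsAntidiagonal e, ((#(p.1 * p.2).divisors : ℕ) : ℝ) ^ j / (p.1 * p.2 : ℕ) := by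
    intro e _
    have hconst : ∀ p ∈ Nat.divisorsAntidiagonal e,
        ((#(p.1 * p.2).divisors : ℕ) : ℝ) ^ j / (p.1 * p.2 : ℕ) = ((#e.divisors : ℕ) : ℝ) ^ j / e := by
      intro p hp
      rw [(Nat.mem_divisorsAntidiagonal.mp hp).1]
    rw [sum_congr rfl hconst, sum_const, card_divisorsAntidiagonal_eq, nsmul_eq_mul, pow_succ]
    ring
  rw [sum_congr rfl h1]
  have h2 : ∀ e ∈ Icc 1 K, ∑ p ∈ Nat.divisorsAntidiagonal e,
      ((#(p.1 * p.2).divisors : ℕ) : ℝ) ^ j / (p.1 * p.2 : ℕ) ≤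
      ∑ p ∈ Nat.divisorsAntidiagonal e,
        ((#p.1.divisors : ℕ) : ℝ) ^ j / p.1 * (((#p.2.divisors : ℕ) : ℝ) ^ j / p.2) := by
    intro e _
    refine sum_le_sum fun p hp => ?_
    have hd : ((#(p.1 * p.2).divisors : ℕ) : ℝ) ^ j ≤ ((#p.1.divisors : ℕ) : ℝ) ^ j * ((#p.2.divisors : ℕ) : ℝ) ^ j := by
      rw [← mul_pow]
      exact pow_le_pow_left₀ (by positivity) (by exact_mod_cast card_divisors_mul_le p.1 p.2) j
    rw [div_mul_div_comm]
    push_cast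
    exact div_le_div_of_nonneg_right hd (by positivity)
  refine (sum_le_sum h2).trans ?_
  rw [← sum_biUnion]
  · rw [sq, sum_mul_sum, ← sum_product']
    refine sum_le_sum_of_subset_of_nonneg ?_ fun p _ _ => by positivity
    intro p hp
    obtain ⟨e, he, hpe⟩ := mem_biUnion.mp hp
    have hp12 : p.1 * p.2 = e := (Nat.mem_divisorsAntidiagonal.mp hpe).1
    have he0 : e ≠ 0 := (Nat.mem_divisorsAntidiagonal.mp hpe).2
    have heR : e ≤ K := (mem_Icc.mp he).2
    have hp1 : 0 < p.1 := Nat.pos_of_ne_zero fun h => he0 (by rw [← hp12, h, zero_mul])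
    have hp2 : 0 < p.2 := Nat.pos_of_ne_zero fun h => he0 (by rw [← hp12, h, mul_zero])
    refine mem_product.mpr ⟨mem_Icc.mpr ⟨hp1, ?_⟩, mem_Icc.mpr ⟨hp2, ?_⟩⟩
    · calc p.1 ≤ p.1 * p.2 := Nat.le_mul_of_pos_right _ hp2
        _ ≤ K := hp12 ▸ heR
    · calc p.2 ≤ p.1 * p.2 := Nat.le_mul_of_pos_left _ hp1
        _ ≤ K := hp12 ▸ heR
  · intro e _ e' _ hne
    rw [Function.onFun, disjoint_left]
    intro p hp hp'
    exact hne ((Nat.mem_divisorsAntidiagonal.mp hp).1.symm.trans (Nat.mem_divisorsAntidiagonal.mp hp').1)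

/-- `∑_{n ≤ K} τ(n)^j/n ≤ (1 + log K)^{2^j}`. [folklore] -/
theorem sum_tau_pow_div_le (j K : ℕ) :
    ∑ n ∈ Icc 1 K, ((#n.divisors : ℕ) : ℝ) ^ j / n ≤ (1 + Real.log K) ^ (2 ^ j) := by
  induction j with
  | zero =>
    have h := harmonic_le_one_add_log K
    rw [harmonic_eq_sum_Icc] at h
    push_cast at h
    simpa [one_div] using h
  | succ j ih =>
    calc ∑ n ∈ Icc 1 K, ((#n.divisors : ℕ) : ℝ) ^ (j + 1) / n
        ≤ (∑ n ∈ Icc 1 K, ((#n.divisors : ℕ) : ℝ) ^ j / n) ^ 2 := sum_tau_pow_succ_div_le j K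
      _ ≤ ((1 + Real.log K) ^ (2 ^ j)) ^ 2 :=
          pow_le_pow_left₀ (sum_nonneg fun n _ ↦ by positivity) ih 2
      _ = (1 + Real.log K) ^ (2 ^ (j + 1)) := by rw [← pow_mul, pow_succ]

/-- **`∑_{M ≤ Y} τ(M)³ √((M,q))/M ≤ τ(q)⁴ (1 + log Y)⁸`** (`q ≠ 0`): write `M = g m`, `g = (M,q)`,
`τ(M)³ ≤ τ(g)³ τ(m)³ ≤ τ(q)³ τ(m)³`, `√g/g ≤ 1`. [cite: TaoTeravainen2021, §8
("`∑ (d,q_χ)^{1/2} τ(d)^{O(1)}/d … ≪ τ(q_χ)^{O(1)} log^{O(1)} x`")] -/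
theorem sum_tau_cube_sqrt_gcd_div_le {q : ℕ} (hq : q ≠ 0) (Y : ℕ) :
    ∑ M ∈ Icc 1 Y, ((#M.divisors : ℕ) : ℝ) ^ 3 * Real.sqrt (Nat.gcd M q) / M ≤
      ((#q.divisors : ℕ) : ℝ) ^ 4 * (1 + Real.log Y) ^ 8 := by
  classical
  set φ : ℕ → ℕ × ℕ := fun d => (Nat.gcd d q, d / Nat.gcd d q) with hφ
  set G : ℕ × ℕ → ℝ := fun y => ((#y.1.divisors : ℕ) : ℝ) ^ 3 / Real.sqrt y.1 *
    (((#y.2.divisors : ℕ) : ℝ) ^ 3 / y.2) with hG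
  have hG0 : ∀ y, 0 ≤ G y := fun y => by positivity
  have hdecomp : ∀ d : ℕ, Nat.gcd d q * (d / Nat.gcd d q) = d := fun d =>
    Nat.mul_div_cancel' (Nat.gcd_dvd_left d q)
  have hterm : ∀ d ∈ Icc 1 Y, ((#d.divisors : ℕ) : ℝ) ^ 3 * Real.sqrt (Nat.gcd d q) / d ≤ G (φ d) := by
    intro d hd
    rw [mem_Icc] at hd
    set g := Nat.gcd d q with hg
    set m := d / g with hm
    have hg0 : 0 < g := Nat.gcd_pos_of_pos_left q hd.1
    have hgm : g * m = d := hdecomp d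
    have hm0 : 0 < m := Nat.pos_of_ne_zero fun h => by rw [h, mul_zero] at hgm; omega
    have hg0' : (0 : ℝ) < g := by exact_mod_cast hg0
    have hm0' : (0 : ℝ) < m := by exact_mod_cast hm0
    have hsg : 0 < Real.sqrt g := Real.sqrt_pos.mpr hg0'
    have hτ : ((#d.divisors : ℕ) : ℝ) ≤ ((#g.divisors : ℕ) : ℝ) * ((#m.divisors : ℕ) : ℝ) := by
      rw [← hgm]; exact_mod_cast card_divisors_mul_le g m
    have hτ3 : ((#d.divisors : ℕ) : ℝ) ^ 3 ≤ ((#g.divisors : ℕ) : ℝ) ^ 3 * ((#m.divisors : ℕ) : ℝ) ^ 3 := by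
      rw [← mul_pow]; exact pow_le_pow_left₀ (by positivity) hτ 3
    have hd' : (d : ℝ) = g * m := by rw [← hgm]; push_cast; ring
    simp only [hG, hφ]
    rw [← hg, ← hm, hd', div_le_iff₀ (by positivity)]
    calc ((#d.divisors : ℕ) : ℝ) ^ 3 * Real.sqrt g
        ≤ ((#g.divisors : ℕ) : ℝ) ^ 3 * ((#m.divisors : ℕ) : ℝ) ^ 3 * Real.sqrt g :=
          mul_le_mul_of_nonneg_right hτ3 hsg.le
      _ = ((#g.divisors : ℕ) : ℝ) ^ 3 / Real.sqrt g * (((#m.divisors : ℕ) : ℝ) ^ 3 / m) * (g * m) := by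
          have hgg : Real.sqrt g * Real.sqrt g = g := Real.mul_self_sqrt hg0'.le
          set sg := Real.sqrt (g : ℝ) with hsgdef
          rw [← hgg]
          field_simp
  have hinj : Set.InjOn φ (Icc 1 Y : Finset ℕ) := by
    intro a _ b _ hab
    simp only [hφ, Prod.mk.injEq] at hab
    calc a = Nat.gcd a q * (a / Nat.gcd a q) := (hdecomp a).symm
      _ = Nat.gcd b q * (b / Nat.gcd b q) := by rw [hab.2, hab.1]
      _ = b := hdecomp b
  have hrange : (Icc 1 Y).image φ ⊆ q.divisors ×ˢ Icc 1 Y := by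
    intro y hy
    rw [mem_image] at hy
    obtain ⟨d, hd, rfl⟩ := hy
    rw [mem_Icc] at hd
    rw [mem_product, Nat.mem_divisors, mem_Icc]
    have hg0 : 0 < Nat.gcd d q := Nat.gcd_pos_of_pos_left q hd.1
    refine ⟨⟨Nat.gcd_dvd_right d q, hq⟩, ?_, (Nat.div_le_self _ _).trans hd.2⟩
    exact Nat.div_pos (Nat.le_of_dvd hd.1 (Nat.gcd_dvd_left d q)) hg0
  have h1 : ∑ g ∈ q.divisors, ((#g.divisors : ℕ) : ℝ) ^ 3 / Real.sqrt g ≤ ((#q.divisors : ℕ) : ℝ) ^ 4 := by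
    calc ∑ g ∈ q.divisors, ((#g.divisors : ℕ) : ℝ) ^ 3 / Real.sqrt g
        ≤ ∑ _g ∈ q.divisors, ((#q.divisors : ℕ) : ℝ) ^ 3 := by
          refine sum_le_sum fun g hg => ?_
          have hg1 : (1 : ℝ) ≤ g := by exact_mod_cast Nat.pos_of_mem_divisors hg
          have hle : ((#g.divisors : ℕ) : ℝ) ≤ ((#q.divisors : ℕ) : ℝ) := by
            exact_mod_cast card_le_card (Nat.divisors_subset_of_dvd hq (Nat.dvd_of_mem_divisors hg))
          calc ((#g.divisors : ℕ) : ℝ) ^ 3 / Real.sqrt g ≤ ((#g.divisors : ℕ) : ℝ) ^ 3 / 1 :=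
                div_le_div_of_nonneg_left (by positivity) one_pos (Real.one_le_sqrt.mpr hg1)
            _ ≤ ((#q.divisors : ℕ) : ℝ) ^ 3 := by rw [div_one]; exact pow_le_pow_left₀ (by positivity) hle 3
      _ = ((#q.divisors : ℕ) : ℝ) ^ 4 := by rw [sum_const, nsmul_eq_mul, pow_succ' _ 3]
  have h2 := sum_tau_pow_div_le 3 Y
  calc ∑ d ∈ Icc 1 Y, ((#d.divisors : ℕ) : ℝ) ^ 3 * Real.sqrt (Nat.gcd d q) / d
      ≤ ∑ d ∈ Icc 1 Y, G (φ d) := sum_le_sum hterm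
    _ = ∑ y ∈ (Icc 1 Y).image φ, G y := (sum_image hinj).symm
    _ ≤ ∑ y ∈ q.divisors ×ˢ Icc 1 Y, G y := sum_le_sum_of_subset_of_nonneg hrange fun y _ _ => hG0 y
    _ = (∑ g ∈ q.divisors, ((#g.divisors : ℕ) : ℝ) ^ 3 / Real.sqrt g) *
          ∑ m ∈ Icc 1 Y, ((#m.divisors : ℕ) : ℝ) ^ 3 / m := by
        rw [sum_product, sum_mul_sum]
    _ ≤ ((#q.divisors : ℕ) : ℝ) ^ 4 * (1 + Real.log Y) ^ 8 := by
        refine mul_le_mul h1 (by simpa using h2) (sum_nonneg fun m _ => by positivity) (by positivity)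

/-! ### The sum over the triples `(b, e, e')` -/

/-- The combined modulus of a triple: `[b, [e, e']]`. [cite: TaoTeravainen2021, §8] -/
def tripleLcm (t : ℕ × ℕ × ℕ) : ℕ := Nat.lcm t.1 (Nat.lcm t.2.1 t.2.2)

/-- **`∑_{(b,e,e')} √(([b,[e,e']], q))/[b,[e,e']] ≤ ∑_{M ≤ Y} τ(M)³ √((M,q))/M`** whenever all
`[b,[e,e']] ≤ Y` and the components are `≥ 1` (the fibre of `M` has at most `τ(M)³` triples).
[cite: TaoTeravainen2021, §8 ("on evaluating the `d'_j` sums, and then writing `d := d₁⋯d_k`")] -/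
theorem sum_triples_sqrt_gcd_div_lcm_le (q : ℕ) (T : Finset (ℕ × ℕ × ℕ)) {Y : ℕ}
    (hT : ∀ t ∈ T, 1 ≤ t.1 ∧ 1 ≤ t.2.1 ∧ 1 ≤ t.2.2 ∧ tripleLcm t ≤ Y) :
    ∑ t ∈ T, Real.sqrt (Nat.gcd (tripleLcm t) q) / tripleLcm t ≤
      ∑ M ∈ Icc 1 Y, ((#M.divisors : ℕ) : ℝ) ^ 3 * Real.sqrt (Nat.gcd M q) / M := by
  classical
  have hM1 : ∀ t ∈ T, 1 ≤ tripleLcm t := by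
    intro t ht
    obtain ⟨h1, h2, h3, -⟩ := hT t ht
    exact Nat.pos_of_ne_zero (Nat.lcm_ne_zero (by omega) (Nat.lcm_ne_zero (by omega) (by omega)))
  rw [← sum_fiberwise_of_maps_to (g := tripleLcm) (t := Icc 1 Y)
    (fun t ht => mem_Icc.mpr ⟨hM1 t ht, (hT t ht).2.2.2⟩)]
  refine sum_le_sum fun M hM => ?_
  have hM0 : M ≠ 0 := by rw [mem_Icc] at hM; omega
  rw [sum_congr rfl fun t ht => by rw [(mem_filter.mp ht).2], sum_const, nsmul_eq_mul]
  rw [mul_div_assoc]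
  refine mul_le_mul_of_nonneg_right ?_ (by positivity)
  -- the fibre injects into `divisors³`
  have hsub : ∀ t ∈ T.filter (fun t => tripleLcm t = M), t ∈ M.divisors ×ˢ M.divisors ×ˢ M.divisors := by
    intro t ht
    rw [mem_filter] at ht
    obtain ⟨ht, hM'⟩ := ht
    simp only [mem_product, Nat.mem_divisors]
    refine ⟨⟨?_, hM0⟩, ⟨?_, hM0⟩, ⟨?_, hM0⟩⟩
    · rw [← hM']; exact Nat.dvd_lcm_left _ _
    · rw [← hM']; exact (Nat.dvd_lcm_left _ _).trans (Nat.dvd_lcm_right _ _)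
    · rw [← hM']; exact (Nat.dvd_lcm_right _ _).trans (Nat.dvd_lcm_right t.1 _)
  have hcard := Finset.card_le_card (show T.filter (fun t => tripleLcm t = M) ⊆ M.divisors ×ˢ M.divisors ×ˢ M.divisors
    from hsub)
  rw [card_product, card_product] at hcard
  calc ((#(T.filter (fun t => tripleLcm t = M)) : ℕ) : ℝ) ≤ ((#M.divisors * (#M.divisors * #M.divisors) : ℕ) : ℝ) := by
        exact_mod_cast hcard
    _ = ((#M.divisors : ℕ) : ℝ) ^ 3 := by push_cast; ring

end TaoTeravainen

end Literature.Barriers.Parity
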